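import Literature.NumberTheory.LFunctions.SelbergFujiiGapMoment
import Literature.NumberTheory.LFunctions.SelbergFujiiPrimeSums
import HarnessLib

/-!
# Selberg–Fujii: both gap facts from Selberg's mean-value approximate formula for `S(t)` — proofs

Trunk T-ANT (`Literature/NumberTheory/LFunctions`). Proofs only (no definitions, no named facts).
Seventh file of the Selberg–Fujii cluster (`ZeroGaps.lean`: the named facts
`Literature.NumberTheory.LFunctions.selberg_fujii_large_gaps` (9.25.5) and `…small_gaps` (9.25.6);
`ZeroGapsProofs.lean`, `SelbergFujiiLargeGaps.lean`, `SelbergFujiiMoments.lean`,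
`SelbergFujiiSmallGaps.lean`, `SelbergFujiiGapMoment.lean`: all of Titchmarsh §9.26 and the
deduction of (9.25.4)₂, leaving two one-sided moment bounds `hS` (`L¹` from below at one scale)
and `h2` (`L²` from above) for `S(t + h) − S(t)`; `SelbergFujiiPrimeSums.lean`: mean values of the
prime polynomial `Q_h(t) = ∑_{p ≤ N} p^{-1/2}(p^{-ih} − 1) p^{-it}`).

## Main results (all PROVED)

* `Literature.NumberTheory.LFunctions.selberg_fujii_small_gaps_of_approxFormula`,
  `Literature.NumberTheory.LFunctions.selberg_fujii_large_gaps_of_approxFormula` — BOTH named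
  facts of `ZeroGaps.lean` follow from the single hypothesis
  `hAF : ∃ 0 < a < b ≤ 1/4, ∃ C T₀, ∀ T ≥ T₀, ∀ y ∈ [T^a, T^b],
     ∫_{T/2}^{T} (S(t) + π⁻¹ ∑_{p ≤ y} sin(t log p)/√p)² dt ≤ C T`,
  the display of Titchmarsh's Theorem 14.22 (`∫_{T/2}^{T} {S(t) + π⁻¹ ∑_{p < x²} sin(t log p)/√p}² dt
  = O(T)` for `T^{a'} ≤ x ≤ T^{1/2}`; take `x² = ⌊y⌋ + ½`). Titchmarsh proves Theorem 14.22 in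
  Chapter XIV, i.e. on the Riemann hypothesis; the unconditional mean-value theorem is Selberg's
  (*Contributions to the theory of the Riemann zeta-function*, 1946), whose treatment of the zeros
  off the critical line rests on his density theorem, Titchmarsh Thm. 9.19 (C) — see Titchmarsh's
  notes §9.25 ("the key feature used in (5) ... being the estimate given in Theorem 9.19 (C)") and
  §14.35. It is NOT proved in the tree and NOT vendored as a named fact (D-0026); it is now the
  whole remaining analytic input of the cluster.
* `SelbergFujii.abs_moment_of_approxFormula` — `hAF ⟹ hS`: there are `M ∈ ℕ`, `c₁ > 0` with
  `∫_T^{2T} |S(t+h) − S(t)| dt ≥ c₁ T` for large `T` and `2πM ≤ h log T ≤ 4πM`.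
* `SelbergFujii.meanSquare_block_of_approxFormula` — `hAF ⟹` the block form of `h2`:
  `∫_T^{2T} (S(t+h) − S(t))² dt ≤ A T log(3 + h log T)` (`T ≥ T₁`, `0 ≤ h ≤ 1`).
* `SelbergFujii.meanSquare_of_block` — block form `⟹ h2` on `[0, T]` (dyadic summation down to a
  fixed height, below which `S` is bounded).

## The proofs

Fix `T` large and put `y = (4T)^a`, `N = ⌊y⌋` (`SelbergFujii.exists_threshold`: `y` is admissible
for both windows `[T, 2T]` and `[2T, 4T]` of `hAF`, `N ≥ 250`, `N⁴ ≤ 4T`), `P(t) = ∑_{p ≤ N}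
sin(t log p)/√p`, `E = S + π⁻¹P`, `Q_h(t) = ∑_{p ≤ N} p^{-1/2}(p^{-ih} − 1)p^{-it}`, so that
`S(t+h) − S(t) = E(t+h) − E(t) + π⁻¹ Im Q_h(t)` (`SelbergFujii.im_primeSum_coeff_eq_neg_sub`) and
`∫_T^{2T} E² ≤ 2CT`, `∫_{2T}^{4T} E² ≤ 4CT`.
* `hS`: on `[T, 2T − 1]`, `|ΔS| ≥ π⁻¹|Im Q_h| − |E(t+h)| − |E(t)|`; `∫_T^{2T}|E| ≤ (T + ∫E²)/2 ≤
  (½ + C)T` (and the same for the shift, which stays inside `[T, 2T]`); `∫_T^{2T}|Im Q_h| ≥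
  (3/128) T V^{1/2}` (`SelbergFujii.le_integral_abs_im_primeSum`, valid as `T ≥ 17N³`),
  `|Im Q_h| ≤ 2N` on the last unit interval, and the variance `V = ∑_{p ≤ N} 2(1 − cos(h log p))/p`
  exceeds `V₀ = (128π(3 + 2C)/3)²` as soon as `h log N ≥ L₀(V₀)` (`SelbergFujii.variance_ge`),
  which holds for `h log T ≥ 2πM` with `M ≥ (L₀ + 1)/(πa)` since `log N ≥ a log T − 1`. Net:
  `∫_T^{2T}|ΔS| ≥ (3 + 2C)T − 2N/π − (1 + 2C)T ≥ T`.
* `h2` (blocks): `(ΔE + π⁻¹Im Q_h)² ≤ 3(E(t+h)² + E² + π⁻²(Im Q_h)²)`; `∫_T^{2T} E(t+h)² ≤ ∫_T^{4T} E²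
  ≤ 6CT`; `∫ (Im Q_h)² ≤ ∫|Q_h|² ≤ (T + 8N(1 + log N))V ≤ 2TV`
  (`SelbergFujii.abs_integral_norm_sq_primeSum_sub_le`) and
  `V ≤ 4 log(2 + h log N) + 70 ≤ 74 log(3 + h log T)` (`SelbergFujii.variance_le`); so
  `A = 24C + 50`.
* `h2` (full): `∫_{T/2^k}^{T} ≤ A T log(3 + h log T)(1 − 2^{−k})` by induction over the blocks (the
  logarithm only decreases), `k` with `T₁ ≤ T/2^k < 2T₁`, and `∫_0^{2T₁} (ΔS)² ≤ (2 sup|S|)² 2T₁`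
  uniformly in `0 ≤ h ≤ 1`.

## References

* E. C. Titchmarsh, *The Theory of the Riemann Zeta-Function*, 2nd ed. revised by
  D. R. Heath-Brown (1986): Thm. 14.22 and §§14.20–14.24 (Selberg's method, on RH), §9.25
  (notes: Selberg's unconditional treatment, Thm. 9.19 (C)), §14.35, §9.26. [key `Titchmarsh1986`]
* A. Selberg, *Contributions to the theory of the Riemann zeta-function*, Arch. Math. Naturvid.
  48 (1946), no. 5, 89–155 (the unconditional mean-value approximate formula for `S(t)`).
* A. Fujii, Bull. Amer. Math. Soc. 81 (1975), 139–142; Proc. Japan Acad. 51 (1975), 741–743.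
-/

noncomputable section

open Real MeasureTheory Set Filter Complex
open scoped ComplexConjugate

namespace Literature.NumberTheory.LFunctions

namespace SelbergFujii

/-! ### Helpers: `S` on compact intervals, the prime polynomial, sizes -/

/-- `S(t)` is bounded on every compact interval (`0 ≤ N(t) ≤ N(b)`, `θ` continuous). [folklore] -/
theorem exists_abs_zetaArgS_le (a b : ℝ) : ∃ C : ℝ, 0 ≤ C ∧ ∀ t ∈ Icc a b, |zetaArgS t| ≤ C := by
  obtain ⟨Cθ, hCθ⟩ := (isCompact_Icc (a := a) (b := b)).exists_bound_of_continuousOn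
    continuous_riemannSiegelTheta.continuousOn
  have hπ : 3 < π := Real.pi_gt_three
  refine ⟨zetaZeroCount b + |Cθ| + 1, by positivity, fun t ht ↦ ?_⟩
  have hmN := monotone_zetaZeroCount_real
  have h1 : (zetaZeroCount t : ℝ) ≤ zetaZeroCount b := hmN ht.2
  have h0 : (0 : ℝ) ≤ zetaZeroCount t := Nat.cast_nonneg _
  have h2 := hCθ t ht
  rw [Real.norm_eq_abs] at h2
  have h3 : |riemannSiegelTheta t / π| ≤ |Cθ| := by
    rw [abs_div, abs_of_pos Real.pi_pos, div_le_iff₀ Real.pi_pos]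
    nlinarith [le_abs_self Cθ, abs_nonneg Cθ, abs_nonneg (riemannSiegelTheta t)]
  rw [zetaArgS, abs_le]
  rw [abs_le] at h3
  constructor <;> linarith [h3.1, h3.2]

/-- Continuity in `t` of the prime sine polynomial `P(t) = ∑_{p ≤ N} sin(t log p)/√p`. [folklore] -/
theorem continuous_primeSin (N : ℕ) :
    Continuous fun t : ℝ ↦ ∑ p ∈ Nat.primesLE N, Real.sin (t * Real.log p) / Real.sqrt p := by
  refine continuous_finsetSum _ fun p _ ↦ ?_
  fun_prop

/-- `Im ∑_p b_p p^{-it} = −(P(t + h) − P(t))` for `b_p = p^{-1/2}(p^{-ih} − 1)`. [folklore] -/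
theorem im_primeSum_coeff_eq_neg_sub (N : ℕ) (h t : ℝ) :
    (∑ p ∈ Nat.primesLE N, (Real.sqrt p : ℂ)⁻¹ * ((p : ℂ) ^ (-((h : ℂ) * I)) - 1) *
        (p : ℂ) ^ (-((t : ℂ) * I))).im =
      -((∑ p ∈ Nat.primesLE N, Real.sin ((t + h) * Real.log p) / Real.sqrt p) -
          ∑ p ∈ Nat.primesLE N, Real.sin (t * Real.log p) / Real.sqrt p) := by
  rw [im_primeSum_coeff, ← Finset.sum_sub_distrib]
  congr 1
  exact Finset.sum_congr rfl fun p _ ↦ by rw [sub_div]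

/-- The crude bound `|Im ∑_p b_p p^{-it}| ≤ 2N` (`|b_p| ≤ 2`). [folklore] -/
theorem abs_im_primeSum_coeff_le (N : ℕ) (h t : ℝ) :
    |(∑ p ∈ Nat.primesLE N, (Real.sqrt p : ℂ)⁻¹ * ((p : ℂ) ^ (-((h : ℂ) * I)) - 1) *
        (p : ℂ) ^ (-((t : ℂ) * I))).im| ≤ 2 * N := by
  refine (Complex.abs_im_le_norm _).trans ((norm_sum_le _ _).trans ?_)
  have hcard : ((Nat.primesLE N).card : ℝ) ≤ N := by
    have : (Nat.primesLE N).card ≤ (Finset.Icc 1 N).card :=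
      Finset.card_le_card fun p hp ↦ by
        rw [Nat.mem_primesLE] at hp
        exact Finset.mem_Icc.2 ⟨hp.2.one_le, hp.1⟩
    simp only [Nat.card_Icc, add_tsub_cancel_right] at this
    exact_mod_cast this
  calc ∑ p ∈ Nat.primesLE N, ‖(Real.sqrt p : ℂ)⁻¹ * ((p : ℂ) ^ (-((h : ℂ) * I)) - 1) *
          (p : ℂ) ^ (-((t : ℂ) * I))‖
      ≤ ∑ p ∈ Nat.primesLE N, (2 : ℝ) := by
        refine Finset.sum_le_sum fun p hp ↦ ?_
        have hpp := (Nat.mem_primesLE.1 hp).2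
        have hp0 : p ≠ 0 := hpp.ne_zero
        have hp1 : (1 : ℝ) ≤ Real.sqrt p := by
          rw [← Real.sqrt_one]; exact Real.sqrt_le_sqrt (by exact_mod_cast hpp.one_le)
        rw [norm_mul, norm_mul, natCast_cpow_neg_mul_I hp0 t, Complex.norm_exp_ofReal_mul_I, mul_one,
          norm_inv, Complex.norm_real, Real.norm_eq_abs, abs_of_nonneg (Real.sqrt_nonneg _)]
        have h2 : ‖(p : ℂ) ^ (-((h : ℂ) * I)) - 1‖ ≤ 2 := by
          calc ‖(p : ℂ) ^ (-((h : ℂ) * I)) - 1‖ ≤ ‖(p : ℂ) ^ (-((h : ℂ) * I))‖ + ‖(1 : ℂ)‖ :=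
                norm_sub_le _ _
            _ = 2 := by
                rw [natCast_cpow_neg_mul_I hp0 h, Complex.norm_exp_ofReal_mul_I, norm_one]; norm_num
        have hinv : (Real.sqrt p)⁻¹ ≤ 1 := inv_le_one_of_one_le₀ hp1
        calc (Real.sqrt p)⁻¹ * ‖(p : ℂ) ^ (-((h : ℂ) * I)) - 1‖ ≤ 1 * 2 :=
              mul_le_mul hinv h2 (norm_nonneg _) zero_le_one
          _ = 2 := one_mul _
    _ = 2 * (Nat.primesLE N).card := by rw [Finset.sum_const, nsmul_eq_mul, mul_comm]
    _ ≤ 2 * N := by linarith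

/-- **Thresholds in `T`.** For exponents `0 < a < b ≤ 1/4` and all large `T`: the length
`y = (4T)^a` is admissible for the windows `[T, 2T]` and `[2T, 4T]` (i.e.
`(2T)^a ≤ y ≤ (2T)^b` and `(4T)^a ≤ y ≤ (4T)^b`), and `N = ⌊y⌋` has `N ≥ 250`, `N⁴ ≤ 4T`.
[folklore] -/
theorem exists_threshold {a b : ℝ} (ha : 0 < a) (hab : a < b) (hb : b ≤ 1 / 4) :
    ∃ T₁ : ℝ, 1 ≤ T₁ ∧ ∀ T : ℝ, T₁ ≤ T →
      (2 * T) ^ a ≤ (4 * T) ^ a ∧ (4 * T) ^ a ≤ (2 * T) ^ b ∧ (4 * T) ^ a ≤ (4 * T) ^ b ∧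
        250 ≤ ⌊(4 * T) ^ a⌋₊ ∧ ((⌊(4 * T) ^ a⌋₊ : ℕ) : ℝ) ^ 4 ≤ 4 * T := by
  have hba : 0 < b - a := by linarith
  refine ⟨max 1 (max ((2 : ℝ) ^ (a / (b - a))) ((250 : ℝ) ^ (1 / a))), le_max_left _ _,
    fun T hT ↦ ?_⟩
  simp only [max_le_iff] at hT
  obtain ⟨hT1, hT2, hT3⟩ := hT
  have hT0 : 0 < T := by linarith
  have h2T : (0 : ℝ) ≤ 2 * T := by linarith
  have h4T : (0 : ℝ) ≤ 4 * T := by linarith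
  have h4T1 : (1 : ℝ) ≤ 4 * T := by linarith
  refine ⟨Real.rpow_le_rpow h2T (by linarith) ha.le, ?_, ?_, ?_, ?_⟩
  · -- `(4T)^a = 2^a (2T)^a ≤ (2T)^a (2T)^{b-a} = (2T)^b`
    have e1 : (4 * T) ^ a = (2 : ℝ) ^ a * (2 * T) ^ a := by
      rw [show (4 : ℝ) * T = 2 * (2 * T) by ring, Real.mul_rpow (by norm_num) h2T]
    have e2 : (2 * T) ^ b = (2 * T) ^ a * (2 * T) ^ (b - a) := by
      rw [← Real.rpow_add (by linarith)]; congr 1; ring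
    have h3 : (2 : ℝ) ^ a ≤ (2 * T) ^ (b - a) := by
      have : ((2 : ℝ) ^ (a / (b - a))) ^ (b - a) = (2 : ℝ) ^ a := by
        rw [← Real.rpow_mul (by norm_num)]; congr 1; field_simp
      rw [← this]
      exact Real.rpow_le_rpow (by positivity) (by linarith) hba.le
    rw [e1, e2, mul_comm]
    exact mul_le_mul_of_nonneg_left h3 (by positivity)
  · exact Real.rpow_le_rpow_of_exponent_le h4T1 hab.le
  · refine Nat.le_floor ?_
    have : ((250 : ℝ) ^ (1 / a)) ^ a = 250 := by
      rw [← Real.rpow_mul (by norm_num)]; rw [one_div_mul_cancel ha.ne', Real.rpow_one]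
    push_cast
    rw [← this]
    exact Real.rpow_le_rpow (by positivity) (by linarith) ha.le
  · have hy : ((⌊(4 * T) ^ a⌋₊ : ℕ) : ℝ) ≤ (4 * T) ^ (1 / 4 : ℝ) :=
      (Nat.floor_le (by positivity)).trans (Real.rpow_le_rpow_of_exponent_le h4T1 (hab.le.trans hb))
    calc ((⌊(4 * T) ^ a⌋₊ : ℕ) : ℝ) ^ 4 ≤ ((4 * T) ^ (1 / 4 : ℝ)) ^ 4 :=
          pow_le_pow_left₀ (Nat.cast_nonneg _) hy 4
      _ = 4 * T := by
          rw [← Real.rpow_natCast, ← Real.rpow_mul h4T]; norm_num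

/-- Polynomial sizes of `N` against `T ≥ N⁴/4`, `N ≥ 250` (`log N ≤ N`). [folklore] -/
theorem sizes_of_le {N : ℕ} {T : ℝ} (hN : 250 ≤ N) (hNT : ((N : ℕ) : ℝ) ^ 4 ≤ 4 * T) :
    16 * N * (1 + Real.log N) + 6 * N + 8 * N ^ 2 * (1 + Real.log (N ^ 2)) ≤ T ∧
      8 * N * (1 + Real.log N) ≤ T ∧ 2 * (N : ℝ) ≤ T ∧ (N : ℝ) ≤ T ∧ 2 ≤ N := by
  have hN' : (250 : ℝ) ≤ N := by exact_mod_cast hN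
  have hN0 : (0 : ℝ) < N := by linarith
  have hlog : Real.log N ≤ N := by linarith [Real.log_le_sub_one_of_pos hN0]
  have hlog2 : Real.log ((N : ℝ) ^ 2) ≤ 2 * N := by rw [Real.log_pow]; push_cast; linarith
  have hlog0 : 0 ≤ Real.log N := Real.log_nonneg (by linarith)
  have hT : (N : ℝ) ^ 4 / 4 ≤ T := by linarith
  have hN3 : (N : ℝ) ^ 3 * 250 ≤ (N : ℝ) ^ 4 := by nlinarith [pow_nonneg hN0.le 3]
  refine ⟨?_, ?_, ?_, ?_, by omega⟩
  · calc 16 * N * (1 + Real.log N) + 6 * N + 8 * (N : ℝ) ^ 2 * (1 + Real.log ((N : ℝ) ^ 2))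
        ≤ 16 * N * (1 + N) + 6 * N + 8 * (N : ℝ) ^ 2 * (1 + 2 * N) := by
          gcongr
      _ = 16 * (N : ℝ) ^ 3 + 24 * (N : ℝ) ^ 2 + 22 * N := by ring
      _ ≤ 17 * (N : ℝ) ^ 3 := by nlinarith
      _ ≤ T := by nlinarith
  · calc 8 * N * (1 + Real.log N) ≤ 8 * N * (1 + N) := by gcongr
      _ ≤ T := by nlinarith
  · nlinarith
  · nlinarith

/-- `S(· + h) − S` is interval integrable on every interval. [folklore] -/
theorem intervalIntegrable_zetaArgS_shift_sub (h a b : ℝ) :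
    IntervalIntegrable (fun t ↦ zetaArgS (t + h) - zetaArgS t) volume a b := by
  have h1 := (intervalIntegrable_zetaArgS (a + h) (b + h)).comp_add_right h
  simp only [add_sub_cancel_right] at h1
  exact h1.sub (intervalIntegrable_zetaArgS a b)

/-! ### The `L¹` lower bound `hS` from the approximate formula -/

/-- **The one-scale `L¹` lower bound for `S(t + h) − S(t)` from Selberg's mean-value approximate
formula.** Assume (hypothesis `hAF`, the display of Titchmarsh's Theorem 14.22 — proved there on
the Riemann hypothesis for `p < x²`, `T^{a'} ≤ x ≤ T^{1/2}`; the unconditional theorem is Selberg's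
(1946), cf. Titchmarsh's notes §9.25 and §14.35): for some exponents `0 < a < b ≤ 1/4`, some
`C` and all large `T`, `∫_{T/2}^{T} (S(t) + π⁻¹ ∑_{p ≤ y} sin(t log p)/√p)² dt ≤ C T` for every
`T^a ≤ y ≤ T^b`. Then there are `M ∈ ℕ`, `c₁ > 0` with
`∫_T^{2T} |S(t + h) − S(t)| dt ≥ c₁ T` for all large `T` and `2πM ≤ h log T ≤ 4πM` — hypothesis
`hS` of `selberg_fujii_small_gaps_of_abs_moment` / `selberg_fujii_large_gaps_of_abs_moment'`.
Proof: with `E = S + π⁻¹P` (`P` the prime polynomial of length `N = ⌊(4T)^a⌋`),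
`S(t+h) − S(t) = E(t+h) − E(t) + π⁻¹ Im Q_h(t)` (`im_primeSum_coeff_eq_neg_sub`); on `[T, 2T − 1]`
integrate `|ΔS| ≥ π⁻¹|Im Q_h| − |E(t+h)| − |E(t)|`, where `∫_T^{2T}|E| ≤ (T + ∫ E²)/2 ≤ (½ + C)T`
by `hAF` on `[T, 2T]`, `∫_T^{2T} |Im Q_h| ≥ (3/128) T V^{1/2}` (`le_integral_abs_im_primeSum`),
`|Im Q_h| ≤ 2N`, and the variance `V = ∑_{p ≤ N} 2(1 − cos(h log p))/p` exceeds any `V₀` once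
`h log N ≍ a M` is large (`variance_ge`), i.e. once `M` is large in terms of `C` and `a`.
[cite: Titchmarsh1986, Thm. 14.22, §§14.23–14.24 and §9.26] -/
theorem abs_moment_of_approxFormula
    (hAF : ∃ a b : ℝ, 0 < a ∧ a < b ∧ b ≤ 1 / 4 ∧ ∃ C : ℝ, ∃ T₀ : ℝ, ∀ T : ℝ, T₀ ≤ T →
      ∀ y : ℝ, T ^ a ≤ y → y ≤ T ^ b →
        ∫ t in T / 2..T, (zetaArgS t + π⁻¹ * ∑ p ∈ Nat.primesLE ⌊y⌋₊,
          Real.sin (t * Real.log p) / Real.sqrt p) ^ 2 ≤ C * T) :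
    ∃ M : ℕ, 1 ≤ M ∧ ∃ c₁ : ℝ, 0 < c₁ ∧ ∃ T₀ : ℝ, ∀ T : ℝ, T₀ ≤ T → ∀ h : ℝ,
      2 * π * M ≤ h * Real.log T → h * Real.log T ≤ 4 * π * M →
        c₁ * T ≤ ∫ t in T..2 * T, |zetaArgS (t + h) - zetaArgS t| := by
  obtain ⟨a, b, ha, hab, hb, C₀, T₀, hAF⟩ := hAF
  -- WLOG `C ≥ 0`
  obtain ⟨C, hC0, hAF⟩ : ∃ C : ℝ, 0 ≤ C ∧ ∀ T : ℝ, T₀ ≤ T → 0 ≤ T → ∀ y : ℝ, T ^ a ≤ y →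
      y ≤ T ^ b → ∫ t in T / 2..T, (zetaArgS t + π⁻¹ * ∑ p ∈ Nat.primesLE ⌊y⌋₊,
          Real.sin (t * Real.log p) / Real.sqrt p) ^ 2 ≤ C * T :=
    ⟨max C₀ 0, le_max_right _ _, fun T hT hT0 y hy1 hy2 ↦ (hAF T hT y hy1 hy2).trans
      (mul_le_mul_of_nonneg_right (le_max_left _ _) hT0)⟩
  obtain ⟨T₁, hT₁1, hthr⟩ := exists_threshold ha hab hb
  have hπ : 3 < π := Real.pi_gt_three
  -- the variance threshold `V₀` and `L₀`
  set V₀ : ℝ := (128 * π / 3 * (3 + 2 * C)) ^ 2 with hV₀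
  obtain ⟨L₀', hL₀'⟩ := variance_ge V₀
  set L₀ := max L₀' 0 with hL₀def
  have hL₀0 : 0 ≤ L₀ := le_max_right _ _
  have hL₀ : ∀ h : ℝ, 0 < h → h ≤ 1 → ∀ N : ℕ, L₀ ≤ h * Real.log N →
      V₀ ≤ ∑ p ∈ Nat.primesLE N, 2 * (1 - Real.cos (h * Real.log p)) / p :=
    fun h hh hh1 N hL ↦ hL₀' h hh hh1 N ((le_max_left _ _).trans hL)
  -- the constant `M`
  obtain ⟨M, hM1, hML⟩ : ∃ M : ℕ, 1 ≤ M ∧ (L₀ + 1) / (π * a) ≤ M := by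
    obtain ⟨M, hM⟩ := exists_nat_ge ((L₀ + 1) / (π * a))
    exact ⟨max M 1, le_max_right _ _, hM.trans (by exact_mod_cast le_max_left _ _)⟩
  refine ⟨M, hM1, 1, one_pos, max (max T₀ T₁) (Real.exp (4 * π * M)), fun T hT h hh1 hh2 ↦ ?_⟩
  simp only [max_le_iff] at hT
  obtain ⟨⟨hTT₀, hTT₁⟩, hTe⟩ := hT
  have hT1 : 1 ≤ T := hT₁1.trans hTT₁
  have hT0 : 0 < T := by linarith
  have hM : (1 : ℝ) ≤ M := by exact_mod_cast hM1
  have hlogT : 4 * π * M ≤ Real.log T := by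
    rw [← Real.log_exp (4 * π * M)]; exact Real.log_le_log (Real.exp_pos _) hTe
  have hlogpos : 0 < Real.log T := by
    have : (0 : ℝ) < 4 * π * M := by positivity
    linarith
  have hh0 : 0 < h := by
    have : 0 < h * Real.log T := lt_of_lt_of_le (by positivity) hh1
    exact (mul_pos_iff_of_pos_right hlogpos).1 this
  have hh1' : h ≤ 1 := by
    have h1 : h * Real.log T ≤ 1 * Real.log T := by rw [one_mul]; exact hh2.trans hlogT
    exact le_of_mul_le_mul_right h1 hlogpos
  -- the objects at height `T`
  obtain ⟨h2a, hyb, -, hN250, hN4⟩ := hthr T hTT₁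
  set y : ℝ := (4 * T) ^ a with hy
  set N : ℕ := ⌊y⌋₊ with hN
  obtain ⟨hsz1, -, -, hsz4, hN2⟩ := sizes_of_le hN250 hN4
  have hN250' : (250 : ℝ) ≤ N := by exact_mod_cast hN250
  -- `log N ≥ a log T − 1`
  have hlogN : a * Real.log T - 1 ≤ Real.log N := by
    have hy250 : (250 : ℝ) ≤ y := hN250'.trans (Nat.floor_le (by positivity))
    have hNy : y / 2 ≤ N := by
      have := Nat.lt_floor_add_one y
      rw [← hN] at this
      linarith
    have h1 : Real.log (y / 2) ≤ Real.log N := Real.log_le_log (by linarith) hNy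
    have h2 : Real.log (y / 2) = a * Real.log (4 * T) - Real.log 2 := by
      rw [Real.log_div (by linarith) two_ne_zero, hy, Real.log_rpow (by linarith)]
    have h3 : Real.log T ≤ Real.log (4 * T) := Real.log_le_log hT0 (by linarith)
    have h4 : Real.log 2 < 1 := by have := Real.log_two_lt_d9; linarith
    have h5 := mul_le_mul_of_nonneg_left h3 ha.le
    linarith
  set P : ℝ → ℝ := fun t ↦ ∑ p ∈ Nat.primesLE N, Real.sin (t * Real.log p) / Real.sqrt p
    with hP
  set E : ℝ → ℝ := fun t ↦ zetaArgS t + π⁻¹ * P t with hE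
  set bc : ℕ → ℂ := fun p ↦ (Real.sqrt p : ℂ)⁻¹ * ((p : ℂ) ^ (-((h : ℂ) * I)) - 1) with hbc
  set Q : ℝ → ℂ := fun t ↦ ∑ p ∈ Nat.primesLE N, bc p * (p : ℂ) ^ (-((t : ℂ) * I)) with hQ
  set V : ℝ := ∑ p ∈ Nat.primesLE N, 2 * (1 - Real.cos (h * Real.log p)) / p with hV
  -- everything that needs the definitions
  have hPc : Continuous P := continuous_primeSin N
  have hQc : Continuous Q := continuous_primeSum N bc
  have him : ∀ t, (Q t).im = -(P (t + h) - P t) := fun t ↦ im_primeSum_coeff_eq_neg_sub N h t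
  have hQbd : ∀ t, |(Q t).im| ≤ 2 * N := fun t ↦ abs_im_primeSum_coeff_le N h t
  have hV_eq : ∑ p ∈ Nat.primesLE N, ‖bc p‖ ^ 2 = V := sum_norm_sq_coeff N h
  have hVge' : L₀ ≤ h * Real.log N → V₀ ≤ V := fun hL ↦ hL₀ h hh0 hh1' N hL
  have hIQ : 3 / 128 * T * Real.sqrt V ≤ ∫ t in T..2 * T, |(Q t).im| := by
    have := le_integral_abs_im_primeSum N bc hT0.le hsz1
    rwa [hV_eq] at this
  have hE2 : ∫ t in T..2 * T, E t ^ 2 ≤ C * (2 * T) := by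
    have := hAF (2 * T) (by linarith) (by linarith) y h2a hyb
    rwa [show 2 * T / 2 = T by ring] at this
  have hiEab : ∀ a' b' : ℝ, IntervalIntegrable E volume a' b' := fun a' b' ↦
    (intervalIntegrable_zetaArgS a' b').add ((hPc.const_mul π⁻¹).intervalIntegrable a' b')
  have hEm : Measurable E := measurable_zetaArgS.add (measurable_const.mul hPc.measurable)
  have hEbd' : ∃ K : ℝ, ∀ t ∈ Icc T (2 * T), |E t| ≤ K := by
    obtain ⟨CS, -, hCS⟩ := exists_abs_zetaArgS_le T (2 * T)
    obtain ⟨CP, hCP⟩ := (isCompact_Icc (a := T) (b := 2 * T)).exists_bound_of_continuousOn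
      hPc.continuousOn
    refine ⟨CS + |CP|, fun t ht ↦ ?_⟩
    have h1 := hCS t ht
    have h2 := hCP t ht
    rw [Real.norm_eq_abs] at h2
    have h3 : |π⁻¹ * P t| ≤ |CP| := by
      rw [abs_mul, abs_inv, abs_of_pos Real.pi_pos]
      calc π⁻¹ * |P t| ≤ 1 * |P t| :=
            mul_le_mul_of_nonneg_right (inv_le_one_of_one_le₀ (by linarith)) (abs_nonneg _)
        _ ≤ |CP| := by rw [one_mul]; exact h2.trans (le_abs_self _)
    calc |E t| ≤ |zetaArgS t| + |π⁻¹ * P t| := abs_add_le _ _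
      _ ≤ CS + |CP| := add_le_add h1 h3
  have hdecomp : ∀ t, zetaArgS (t + h) - zetaArgS t = (E (t + h) - E t) + π⁻¹ * (Q t).im := by
    intro t
    rw [him t]
    simp only [hE]
    ring
  clear_value V Q bc E P N y
  obtain ⟨K, hEbd⟩ := hEbd'
  have hQi : Continuous fun t ↦ |(Q t).im| := by fun_prop
  -- integrability
  have hiE2 : IntervalIntegrable (fun t ↦ E t ^ 2) volume T (2 * T) :=
    intervalIntegrable_of_abs_le (by linarith) (hEm.pow_const 2) (C := K ^ 2) fun t ht ↦ by
      rw [abs_pow, ← sq_abs K]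
      exact pow_le_pow_left₀ (abs_nonneg _) ((hEbd t ht).trans (le_abs_self K)) 2
  have hiE : IntervalIntegrable (fun t ↦ |E t|) volume T (2 * T) := (hiEab T (2 * T)).abs
  -- (2) `∫_T^{2T} |E| ≤ (1/2 + C) T`
  have hIE : ∫ t in T..2 * T, |E t| ≤ (1 / 2 + C) * T := by
    have hpt : ∀ t ∈ Icc T (2 * T), |E t| ≤ (1 + E t ^ 2) / 2 := fun t _ ↦ by
      have h1 := sq_nonneg (|E t| - 1)
      have h2 := sq_abs (E t)
      nlinarith only [h1, h2]
    have hi2 : IntervalIntegrable (fun t ↦ (1 + E t ^ 2) / 2) volume T (2 * T) :=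
      (intervalIntegrable_const.add hiE2).div_const 2
    have hmono := intervalIntegral.integral_mono_on (by linarith) hiE hi2 hpt
    have e : ∫ t in T..2 * T, (1 + E t ^ 2) / 2 = (T + ∫ t in T..2 * T, E t ^ 2) / 2 := by
      rw [intervalIntegral.integral_div, intervalIntegral.integral_add intervalIntegrable_const hiE2,
        intervalIntegral.integral_const, smul_eq_mul]
      ring
    rw [e] at hmono
    linarith
  -- (3) `∫_T^{2T-1} |E(t + h)| dt ≤ ∫_T^{2T} |E|`
  have hiEh : IntervalIntegrable (fun t ↦ |E (t + h)|) volume T (2 * T - 1) := by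
    have := (hiEab (T + h) (2 * T - 1 + h)).abs.comp_add_right h
    simpa only [add_sub_cancel_right] using this
  have hIEh : ∫ t in T..2 * T - 1, |E (t + h)| ≤ (1 / 2 + C) * T := by
    rw [intervalIntegral.integral_comp_add_right (fun t ↦ |E t|) h]
    calc ∫ t in T + h..2 * T - 1 + h, |E t| ≤ ∫ t in T..2 * T, |E t| :=
          intervalIntegral.integral_mono_interval (by linarith) (by linarith) (by linarith)
            (Eventually.of_forall fun t ↦ abs_nonneg _) hiE
      _ ≤ _ := hIE
  -- (4) the prime polynomial on `[T, 2T - 1]`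
  have hIQtail : ∫ t in 2 * T - 1..2 * T, |(Q t).im| ≤ 2 * N := by
    have := intervalIntegral.integral_mono_on (a := 2 * T - 1) (b := 2 * T) (by linarith)
      (hQi.intervalIntegrable (μ := volume) _ _) intervalIntegrable_const fun t _ ↦ hQbd t
    rwa [intervalIntegral.integral_const, smul_eq_mul, show 2 * T - (2 * T - 1) = 1 by ring,
      one_mul] at this
  have hIQ' : 3 / 128 * T * Real.sqrt V - 2 * N ≤ ∫ t in T..2 * T - 1, |(Q t).im| := by
    have hadd := intervalIntegral.integral_add_adjacent_intervals
      (hQi.intervalIntegrable (μ := volume) T (2 * T - 1))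
      (hQi.intervalIntegrable (μ := volume) (2 * T - 1) (2 * T))
    linarith
  -- (5) the variance is large
  have hVge : V₀ ≤ V := by
    refine hVge' ?_
    have hkey : a * (h * Real.log T) - h ≤ h * Real.log N := by
      have := mul_le_mul_of_nonneg_left hlogN hh0.le
      linarith
    have hML' : L₀ + 1 ≤ π * a * M := by
      have := (div_le_iff₀ (by positivity)).1 hML; linarith
    have h6 := mul_le_mul_of_nonneg_left hh1 ha.le
    linarith
  -- (6) the pointwise decomposition on `[T, 2T - 1]`, integrated
  have hpt : ∀ t ∈ Icc T (2 * T - 1),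
      π⁻¹ * |(Q t).im| - |E (t + h)| - |E t| ≤ |zetaArgS (t + h) - zetaArgS t| := by
    intro t _
    rw [hdecomp t]
    have hπinv : 0 < π⁻¹ := by positivity
    have h1 : |π⁻¹ * (Q t).im| ≤ |E (t + h) - E t + π⁻¹ * (Q t).im| + |E (t + h) - E t| := by
      have := abs_add_le (E (t + h) - E t + π⁻¹ * (Q t).im) (-(E (t + h) - E t))
      rw [abs_neg] at this
      have e : E (t + h) - E t + π⁻¹ * (Q t).im + -(E (t + h) - E t) = π⁻¹ * (Q t).im := by ring
      rw [e] at this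
      exact this
    have h2 : |E (t + h) - E t| ≤ |E (t + h)| + |E t| := abs_sub _ _
    rw [abs_mul, abs_of_pos hπinv] at h1
    linarith
  have hiS := intervalIntegrable_zetaArgS_shift_sub h
  have hiE' : IntervalIntegrable (fun t ↦ |E t|) volume T (2 * T - 1) :=
    hiE.mono_set (by
      rw [uIcc_of_le (by linarith), uIcc_of_le (by linarith)]
      exact Icc_subset_Icc le_rfl (by linarith))
  have hiQ' : IntervalIntegrable (fun t ↦ π⁻¹ * |(Q t).im|) volume T (2 * T - 1) :=
    (hQi.intervalIntegrable (μ := volume) _ _).const_mul π⁻¹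
  have hmain := intervalIntegral.integral_mono_on (by linarith) ((hiQ'.sub hiEh).sub hiE')
    (hiS T (2 * T - 1)).abs hpt
  rw [intervalIntegral.integral_sub (hiQ'.sub hiEh) hiE', intervalIntegral.integral_sub hiQ' hiEh,
    intervalIntegral.integral_const_mul] at hmain
  have hIE' : ∫ t in T..2 * T - 1, |E t| ≤ (1 / 2 + C) * T :=
    (intervalIntegral.integral_mono_interval le_rfl (by linarith) (by linarith)
      (Eventually.of_forall fun t ↦ abs_nonneg _) hiE).trans hIE
  -- (7) extend to `[T, 2T]`
  have hext : ∫ t in T..2 * T - 1, |zetaArgS (t + h) - zetaArgS t| ≤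
      ∫ t in T..2 * T, |zetaArgS (t + h) - zetaArgS t| :=
    intervalIntegral.integral_mono_interval le_rfl (by linarith) (by linarith)
      (Eventually.of_forall fun t ↦ abs_nonneg _) (hiS T (2 * T)).abs
  -- (8) numerics
  have hsqrt : 128 * π / 3 * (3 + 2 * C) ≤ Real.sqrt V := by
    rw [Real.le_sqrt (by positivity) (le_trans (sq_nonneg _) hVge)]
    exact hVge
  have hI1 : (3 + 2 * C) * T ≤ π⁻¹ * (3 / 128 * T * Real.sqrt V) := by
    rw [le_inv_mul_iff₀ (by positivity : (0 : ℝ) < π)]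
    have := mul_le_mul_of_nonneg_left hsqrt (by positivity : (0 : ℝ) ≤ 3 / 128 * T)
    have e : 3 / 128 * T * (128 * π / 3 * (3 + 2 * C)) = π * ((3 + 2 * C) * T) := by ring
    linarith
  have hI2 : π⁻¹ * (2 * (N : ℝ)) ≤ N := by
    rw [inv_mul_le_iff₀ (by positivity : (0 : ℝ) < π)]
    exact mul_le_mul_of_nonneg_right (by linarith only [hπ]) (Nat.cast_nonneg N)
  have hI3 : π⁻¹ * (3 / 128 * T * Real.sqrt V - 2 * N) ≤ π⁻¹ * ∫ t in T..2 * T - 1, |(Q t).im| :=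
    mul_le_mul_of_nonneg_left hIQ' (by positivity)
  rw [mul_sub] at hI3
  linarith

/-! ### The mean-square upper bound `h2` from the approximate formula -/

set_option maxHeartbeats 400000 in
/-- **The mean square of `S(t + h) − S(t)` on dyadic blocks from Selberg's mean-value approximate
formula**: under `hAF` (as in `abs_moment_of_approxFormula`) there are `A`, `T₁ ≥ 1` with
`∫_T^{2T} (S(t+h) − S(t))² dt ≤ A T log(3 + h log T)` for `T ≥ T₁`, `0 ≤ h ≤ 1`.
Proof: `(ΔE + π⁻¹ Im Q_h)² ≤ 3(E(t+h)² + E(t)² + π⁻²(Im Q_h)²)`; `∫_T^{2T} E(t+h)² ≤ ∫_T^{4T} E²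
≤ 6CT` and `∫_T^{2T} E² ≤ 2CT` by `hAF` on `[T, 2T]` and `[2T, 4T]` with the common length
`y = (4T)^a`; `∫ (Im Q_h)² ≤ ∫ |Q_h|² ≤ 2TV` (`abs_integral_norm_sq_primeSum_sub_le`) and
`V ≤ 4 log(2 + h log N) + 70 ≤ 74 log(3 + h log T)` (`variance_le`).
[cite: Titchmarsh1986, Thm. 14.22, §§14.23–14.24] -/
theorem meanSquare_block_of_approxFormula
    (hAF : ∃ a b : ℝ, 0 < a ∧ a < b ∧ b ≤ 1 / 4 ∧ ∃ C : ℝ, ∃ T₀ : ℝ, ∀ T : ℝ, T₀ ≤ T →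
      ∀ y : ℝ, T ^ a ≤ y → y ≤ T ^ b →
        ∫ t in T / 2..T, (zetaArgS t + π⁻¹ * ∑ p ∈ Nat.primesLE ⌊y⌋₊,
          Real.sin (t * Real.log p) / Real.sqrt p) ^ 2 ≤ C * T) :
    ∃ A : ℝ, ∃ T₁ : ℝ, 1 ≤ T₁ ∧ ∀ T : ℝ, T₁ ≤ T → ∀ h : ℝ, 0 ≤ h → h ≤ 1 →
      ∫ t in T..2 * T, (zetaArgS (t + h) - zetaArgS t) ^ 2 ≤
        A * (T * Real.log (3 + h * Real.log T)) := by
  obtain ⟨a, b, ha, hab, hb, C₀, T₀, hAF⟩ := hAF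
  -- WLOG `C ≥ 0`
  obtain ⟨C, hC0, hAF⟩ : ∃ C : ℝ, 0 ≤ C ∧ ∀ T : ℝ, T₀ ≤ T → 0 ≤ T → ∀ y : ℝ, T ^ a ≤ y →
      y ≤ T ^ b → ∫ t in T / 2..T, (zetaArgS t + π⁻¹ * ∑ p ∈ Nat.primesLE ⌊y⌋₊,
          Real.sin (t * Real.log p) / Real.sqrt p) ^ 2 ≤ C * T :=
    ⟨max C₀ 0, le_max_right _ _, fun T hT hT0 y hy1 hy2 ↦ (hAF T hT y hy1 hy2).trans
      (mul_le_mul_of_nonneg_right (le_max_left _ _) hT0)⟩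
  obtain ⟨T₁, hT₁1, hthr⟩ := exists_threshold ha hab hb
  have hπ : 3 < π := Real.pi_gt_three
  refine ⟨24 * C + 50, max (max T₀ T₁) 2, le_trans (by norm_num) (le_max_right _ _),
    fun T hT h hh hh1 ↦ ?_⟩
  simp only [max_le_iff] at hT
  obtain ⟨⟨hTT₀, hTT₁⟩, hT2⟩ := hT
  have hT0 : 0 < T := by linarith
  obtain ⟨h2a, hyb, h4ab, hN250, hN4⟩ := hthr T hTT₁
  set y : ℝ := (4 * T) ^ a with hy
  set N : ℕ := ⌊y⌋₊ with hN
  obtain ⟨-, hsz2, -, hsz4, hN2⟩ := sizes_of_le hN250 hN4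
  have hN250' : (250 : ℝ) ≤ N := by exact_mod_cast hN250
  have hN0 : (0 : ℝ) < N := by linarith
  set P : ℝ → ℝ := fun t ↦ ∑ p ∈ Nat.primesLE N, Real.sin (t * Real.log p) / Real.sqrt p
    with hP
  set E : ℝ → ℝ := fun t ↦ zetaArgS t + π⁻¹ * P t with hE
  set bc : ℕ → ℂ := fun p ↦ (Real.sqrt p : ℂ)⁻¹ * ((p : ℂ) ^ (-((h : ℂ) * I)) - 1) with hbc
  set Q : ℝ → ℂ := fun t ↦ ∑ p ∈ Nat.primesLE N, bc p * (p : ℂ) ^ (-((t : ℂ) * I)) with hQ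
  set V : ℝ := ∑ p ∈ Nat.primesLE N, 2 * (1 - Real.cos (h * Real.log p)) / p with hV
  -- everything that needs the definitions
  have hV0 : 0 ≤ V := Finset.sum_nonneg fun p _ ↦ two_mul_one_sub_cos_div_nonneg _ _
  have hVle1 : V ≤ 4 * Real.log (2 + h * Real.log N) + 70 := variance_le hh hh1 hN2
  have hPc : Continuous P := continuous_primeSin N
  have hQc : Continuous Q := continuous_primeSum N bc
  have him : ∀ t, (Q t).im = -(P (t + h) - P t) := fun t ↦ im_primeSum_coeff_eq_neg_sub N h t
  have hV_eq : ∑ p ∈ Nat.primesLE N, ‖bc p‖ ^ 2 = V := sum_norm_sq_coeff N h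
  have hms : |(∫ t in T..2 * T, ‖Q t‖ ^ 2) - T * V| ≤ 8 * N * (1 + Real.log N) * V := by
    have := abs_integral_norm_sq_primeSum_sub_le N bc T
    rwa [hV_eq] at this
  have hE2a : ∫ t in T..2 * T, E t ^ 2 ≤ C * (2 * T) := by
    have := hAF (2 * T) (by linarith) (by linarith) y h2a hyb
    rwa [show 2 * T / 2 = T by ring] at this
  have hE2b : ∫ t in 2 * T..4 * T, E t ^ 2 ≤ C * (4 * T) := by
    have := hAF (4 * T) (by linarith) (by linarith) y le_rfl h4ab
    rwa [show 4 * T / 2 = 2 * T by ring] at this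
  have hEm : Measurable E := measurable_zetaArgS.add (measurable_const.mul hPc.measurable)
  have hEbd' : ∃ K : ℝ, ∀ t ∈ Icc T (4 * T), |E t| ≤ K := by
    obtain ⟨CS, -, hCS⟩ := exists_abs_zetaArgS_le T (4 * T)
    obtain ⟨CP, hCP⟩ := (isCompact_Icc (a := T) (b := 4 * T)).exists_bound_of_continuousOn
      hPc.continuousOn
    refine ⟨CS + |CP|, fun t ht ↦ ?_⟩
    have h1 := hCS t ht
    have h2 := hCP t ht
    rw [Real.norm_eq_abs] at h2
    have h3 : |π⁻¹ * P t| ≤ |CP| := by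
      rw [abs_mul, abs_inv, abs_of_pos Real.pi_pos]
      calc π⁻¹ * |P t| ≤ 1 * |P t| :=
            mul_le_mul_of_nonneg_right (inv_le_one_of_one_le₀ (by linarith)) (abs_nonneg _)
        _ ≤ |CP| := by rw [one_mul]; exact h2.trans (le_abs_self _)
    calc |E t| ≤ |zetaArgS t| + |π⁻¹ * P t| := abs_add_le _ _
      _ ≤ CS + |CP| := add_le_add h1 h3
  have hdecomp : ∀ t, zetaArgS (t + h) - zetaArgS t = (E (t + h) - E t) + π⁻¹ * (Q t).im := by
    intro t
    rw [him t]
    simp only [hE]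
    ring
  clear_value V Q bc E P N y
  obtain ⟨K, hEbd⟩ := hEbd'
  -- integrability
  have hiE2 : IntervalIntegrable (fun t ↦ E t ^ 2) volume T (4 * T) :=
    intervalIntegrable_of_abs_le (by linarith) (hEm.pow_const 2) (C := K ^ 2) fun t ht ↦ by
      rw [abs_pow, ← sq_abs K]
      exact pow_le_pow_left₀ (abs_nonneg _) ((hEbd t ht).trans (le_abs_self K)) 2
  have hiE2' : IntervalIntegrable (fun t ↦ E t ^ 2) volume T (2 * T) :=
    hiE2.mono_set (by
      rw [uIcc_of_le (by linarith), uIcc_of_le (by linarith)]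
      exact Icc_subset_Icc le_rfl (by linarith))
  have hiE2'' : IntervalIntegrable (fun t ↦ E t ^ 2) volume (2 * T) (4 * T) :=
    hiE2.mono_set (by
      rw [uIcc_of_le (by linarith), uIcc_of_le (by linarith)]
      exact Icc_subset_Icc (by linarith) le_rfl)
  have hiE2h : IntervalIntegrable (fun t ↦ E (t + h) ^ 2) volume T (2 * T) :=
    intervalIntegrable_of_abs_le (by linarith) ((hEm.comp (measurable_id.add_const h)).pow_const 2)
      (C := K ^ 2) fun t ht ↦ by
        rw [abs_pow, ← sq_abs K]
        exact pow_le_pow_left₀ (abs_nonneg _)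
          ((hEbd (t + h) ⟨by linarith [ht.1], by linarith [ht.2]⟩).trans (le_abs_self K)) 2
  -- (2) `∫_T^{2T} E(t+h)² ≤ 6CT`
  have hEh : ∫ t in T..2 * T, E (t + h) ^ 2 ≤ 6 * C * T := by
    rw [intervalIntegral.integral_comp_add_right (fun t ↦ E t ^ 2) h]
    have hmono : ∫ t in T + h..2 * T + h, E t ^ 2 ≤ ∫ t in T..4 * T, E t ^ 2 :=
      intervalIntegral.integral_mono_interval (by linarith) (by linarith) (by linarith)
        (Eventually.of_forall fun t ↦ sq_nonneg _) hiE2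
    have hadd := intervalIntegral.integral_add_adjacent_intervals hiE2' hiE2''
    linarith
  -- (3) the prime polynomial
  have hQ2 : ∫ t in T..2 * T, (Q t).im ^ 2 ≤ 2 * T * V := by
    rw [abs_le] at hms
    have hi1 : IntervalIntegrable (fun t ↦ (Q t).im ^ 2) volume T (2 * T) :=
      (by fun_prop : Continuous fun t ↦ (Q t).im ^ 2).intervalIntegrable _ _
    have hi2 : IntervalIntegrable (fun t ↦ ‖Q t‖ ^ 2) volume T (2 * T) :=
      (by fun_prop : Continuous fun t ↦ ‖Q t‖ ^ 2).intervalIntegrable _ _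
    have hkey : 8 * N * (1 + Real.log N) * V ≤ T * V := mul_le_mul_of_nonneg_right hsz2 hV0
    calc ∫ t in T..2 * T, (Q t).im ^ 2 ≤ ∫ t in T..2 * T, ‖Q t‖ ^ 2 := by
          refine intervalIntegral.integral_mono_on (by linarith) hi1 hi2 fun t _ ↦ ?_
          have h1 : |(Q t).im| ≤ ‖Q t‖ := Complex.abs_im_le_norm _
          calc (Q t).im ^ 2 = |(Q t).im| ^ 2 := (sq_abs _).symm
            _ ≤ ‖Q t‖ ^ 2 := pow_le_pow_left₀ (abs_nonneg _) h1 2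
      _ ≤ T * V + 8 * N * (1 + Real.log N) * V := by linarith [hms.2]
      _ ≤ 2 * T * V := by linarith
  -- (4) the variance from above
  have hℓ1 : 1 ≤ Real.log (3 + h * Real.log T) := by
    rw [← Real.log_exp 1]
    refine Real.log_le_log (Real.exp_pos 1) ?_
    have := Real.exp_one_lt_d9
    have : 0 ≤ h * Real.log T := mul_nonneg hh (Real.log_nonneg (by linarith))
    linarith
  have hVle : V ≤ 74 * Real.log (3 + h * Real.log T) := by
    have hlogN : Real.log N ≤ Real.log T := Real.log_le_log hN0 hsz4
    have hlogN0 : 0 ≤ Real.log N := Real.log_nonneg (by linarith)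
    have hhl := mul_le_mul_of_nonneg_left hlogN hh
    have hhl0 : 0 ≤ h * Real.log N := mul_nonneg hh hlogN0
    have h2 : Real.log (2 + h * Real.log N) ≤ Real.log (3 + h * Real.log T) :=
      Real.log_le_log (by linarith) (by linarith)
    linarith
  -- (5) the pointwise decomposition, integrated
  have hpt : ∀ t ∈ Icc T (2 * T), (zetaArgS (t + h) - zetaArgS t) ^ 2 ≤
      3 * (E (t + h) ^ 2 + E t ^ 2) + 3 * π⁻¹ ^ 2 * (Q t).im ^ 2 := by
    intro t _
    rw [hdecomp t]
    have e : 3 * (E (t + h) ^ 2 + E t ^ 2) + 3 * π⁻¹ ^ 2 * (Q t).im ^ 2 -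
        (E (t + h) - E t + π⁻¹ * (Q t).im) ^ 2 =
        (E (t + h) + E t) ^ 2 + (E (t + h) - π⁻¹ * (Q t).im) ^ 2 + (E t + π⁻¹ * (Q t).im) ^ 2 := by
      ring
    nlinarith [sq_nonneg (E (t + h) + E t), sq_nonneg (E (t + h) - π⁻¹ * (Q t).im),
      sq_nonneg (E t + π⁻¹ * (Q t).im), e]
  have hiS2 : IntervalIntegrable (fun t ↦ (zetaArgS (t + h) - zetaArgS t) ^ 2) volume T (2 * T) :=
    (intervalIntegrable_zetaArgS_sub_pow hT0.le hh hh1 2).mono_set (by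
      rw [uIcc_of_le (by linarith), uIcc_of_le (by linarith)]
      exact Icc_subset_Icc (by linarith) le_rfl)
  have hiQ2 : IntervalIntegrable (fun t ↦ 3 * π⁻¹ ^ 2 * (Q t).im ^ 2) volume T (2 * T) :=
    (by fun_prop : Continuous fun t ↦ 3 * π⁻¹ ^ 2 * (Q t).im ^ 2).intervalIntegrable _ _
  have hmain := intervalIntegral.integral_mono_on (by linarith) hiS2
    (((hiE2h.add hiE2').const_mul 3).add hiQ2) hpt
  rw [intervalIntegral.integral_add ((hiE2h.add hiE2').const_mul 3) hiQ2,
    intervalIntegral.integral_const_mul, intervalIntegral.integral_add hiE2h hiE2',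
    intervalIntegral.integral_const_mul] at hmain
  -- (6) numerics: `π⁻² ≤ 1/9`
  have hπ2 : π⁻¹ ^ 2 ≤ 1 / 9 := by
    rw [inv_pow, ← one_div]
    exact div_le_div_of_nonneg_left zero_le_one (by norm_num) (by nlinarith)
  have hQ2' : 3 * π⁻¹ ^ 2 * ∫ t in T..2 * T, (Q t).im ^ 2 ≤
      50 * (T * Real.log (3 + h * Real.log T)) := by
    have h0 : 0 ≤ ∫ t in T..2 * T, (Q t).im ^ 2 :=
      intervalIntegral.integral_nonneg (by linarith) fun t _ ↦ sq_nonneg _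
    have h1 : 3 * π⁻¹ ^ 2 * ∫ t in T..2 * T, (Q t).im ^ 2 ≤ 3 * (1 / 9) * (2 * T * V) :=
      mul_le_mul (mul_le_mul_of_nonneg_left hπ2 (by norm_num)) hQ2 h0 (by positivity)
    have h2 : 2 * T * V ≤ 2 * T * (74 * Real.log (3 + h * Real.log T)) :=
      mul_le_mul_of_nonneg_left hVle (by linarith)
    have h3 := mul_le_mul_of_nonneg_left h2 (by norm_num : (0 : ℝ) ≤ 3 * (1 / 9))
    have h4 : 0 ≤ T * Real.log (3 + h * Real.log T) := by positivity
    linarith only [h1, h3, h4]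
  have hE' : 3 * ((∫ t in T..2 * T, E (t + h) ^ 2) + ∫ t in T..2 * T, E t ^ 2) ≤
      24 * C * (T * Real.log (3 + h * Real.log T)) := by
    have h1 : 3 * ((∫ t in T..2 * T, E (t + h) ^ 2) + ∫ t in T..2 * T, E t ^ 2) ≤ 24 * C * T := by
      linarith
    have h2 : 24 * C * T ≤ 24 * C * (T * Real.log (3 + h * Real.log T)) := by
      have := mul_le_mul_of_nonneg_left hℓ1 (by positivity : (0 : ℝ) ≤ 24 * C * T)
      linarith
    linarith
  calc ∫ t in T..2 * T, (zetaArgS (t + h) - zetaArgS t) ^ 2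
      ≤ 3 * ((∫ t in T..2 * T, E (t + h) ^ 2) + ∫ t in T..2 * T, E t ^ 2) +
          3 * π⁻¹ ^ 2 * ∫ t in T..2 * T, (Q t).im ^ 2 := hmain
    _ ≤ 24 * C * (T * Real.log (3 + h * Real.log T)) +
          50 * (T * Real.log (3 + h * Real.log T)) := add_le_add hE' hQ2'
    _ = (24 * C + 50) * (T * Real.log (3 + h * Real.log T)) := by ring

/-! ### From dyadic blocks to `[0, T]` -/

/-- **From dyadic blocks to the full range.** If `∫_T^{2T} (S(t+h) − S(t))² ≤ A T log(3 + h log T)`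
for `T ≥ T₁` (`0 ≤ h ≤ 1`), then `∫_0^T (S(t+h) − S(t))² ≤ A' T log(3 + h log T)` for `T ≥ 2T₁`
(`0 ≤ h ≤ 1`): sum the blocks `[T/2^{i+1}, T/2^i]` down to `[T₁, 2T₁)` (the logarithm only
decreases) and bound the bottom `[0, 2T₁]` uniformly in `h` (`S` is bounded on compact sets).
This is hypothesis `h2` of `gap_sq_sum_of_meanSquare` / `selberg_fujii_large_gaps_of_abs_moment'`.
[folklore] -/
theorem meanSquare_of_block
    (hB : ∃ A : ℝ, ∃ T₁ : ℝ, 1 ≤ T₁ ∧ ∀ T : ℝ, T₁ ≤ T → ∀ h : ℝ, 0 ≤ h → h ≤ 1 →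
      ∫ t in T..2 * T, (zetaArgS (t + h) - zetaArgS t) ^ 2 ≤
        A * (T * Real.log (3 + h * Real.log T))) :
    ∃ A : ℝ, ∃ T₀ : ℝ, ∀ T : ℝ, T₀ ≤ T → ∀ h : ℝ, 0 ≤ h → h ≤ 1 →
      ∫ t in (0 : ℝ)..T, (zetaArgS (t + h) - zetaArgS t) ^ 2 ≤
        A * (T * Real.log (3 + h * Real.log T)) := by
  obtain ⟨A₀, T₁, hT₁, hB⟩ := hB
  -- the logarithmic factor
  have hℓ : ∀ T : ℝ, 1 ≤ T → ∀ h : ℝ, 0 ≤ h → 1 ≤ Real.log (3 + h * Real.log T) := by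
    intro T hT h hh
    rw [← Real.log_exp 1]
    refine Real.log_le_log (Real.exp_pos 1) ?_
    have := Real.exp_one_lt_d9
    have : 0 ≤ h * Real.log T := mul_nonneg hh (Real.log_nonneg hT)
    linarith
  have hℓmono : ∀ T T' : ℝ, 1 ≤ T' → T' ≤ T → ∀ h : ℝ, 0 ≤ h →
      Real.log (3 + h * Real.log T') ≤ Real.log (3 + h * Real.log T) := by
    intro T T' hT' hTT' h hh
    have h1 : Real.log T' ≤ Real.log T := Real.log_le_log (by linarith) hTT'
    have h2 : 0 ≤ Real.log T' := Real.log_nonneg hT'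
    exact Real.log_le_log (by nlinarith) (by nlinarith [mul_le_mul_of_nonneg_left h1 hh])
  -- WLOG `A ≥ 0`
  obtain ⟨A, hA0, hB⟩ : ∃ A : ℝ, 0 ≤ A ∧ ∀ T : ℝ, T₁ ≤ T → ∀ h : ℝ, 0 ≤ h → h ≤ 1 →
      ∫ t in T..2 * T, (zetaArgS (t + h) - zetaArgS t) ^ 2 ≤
        A * (T * Real.log (3 + h * Real.log T)) := by
    refine ⟨max A₀ 0, le_max_right _ _, fun T hT h hh hh1 ↦ (hB T hT h hh hh1).trans ?_⟩
    have : 0 ≤ T * Real.log (3 + h * Real.log T) :=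
      mul_nonneg (by linarith) (by linarith [hℓ T (hT₁.trans hT) h hh])
    exact mul_le_mul_of_nonneg_right (le_max_left _ _) this
  -- integrability of `(S(t+h) − S(t))²` on `[a, b] ⊆ [0, ∞)`
  have hiF : ∀ h : ℝ, 0 ≤ h → h ≤ 1 → ∀ a b : ℝ, 0 ≤ a → a ≤ b →
      IntervalIntegrable (fun t ↦ (zetaArgS (t + h) - zetaArgS t) ^ 2) volume a b := by
    intro h hh hh1 a b ha hab
    refine (intervalIntegrable_zetaArgS_sub_pow (T := b / 2) (by linarith) hh hh1 2).mono_set ?_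
    rw [uIcc_of_le hab, uIcc_of_le (by linarith)]
    exact Icc_subset_Icc ha (by linarith)
  -- the dyadic summation
  have hdy : ∀ k : ℕ, ∀ T : ℝ, T₁ ≤ T / 2 ^ k → ∀ h : ℝ, 0 ≤ h → h ≤ 1 →
      ∫ t in T / 2 ^ k..T, (zetaArgS (t + h) - zetaArgS t) ^ 2 ≤
        A * (T * Real.log (3 + h * Real.log T)) * (1 - (1 / 2) ^ k) := by
    intro k
    induction k with
    | zero =>
      intro T hT h hh hh1
      simp
    | succ k ih =>
      intro T hT h hh hh1
      have h2k : (0 : ℝ) < 2 ^ k := by positivity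
      have hT' : T₁ ≤ T / 2 ^ (k + 1) := hT
      have hTpos : 0 < T := by
        have : 0 < T / 2 ^ (k + 1) := lt_of_lt_of_le (by linarith) hT'
        exact (div_pos_iff_of_pos_right (by positivity)).1 this
      have hTk : T / 2 ^ (k + 1) ≤ T / 2 ^ k := by
        rw [pow_succ]
        exact div_le_div_of_nonneg_left hTpos.le h2k (by linarith)
      have hT'1 : 1 ≤ T / 2 ^ (k + 1) := hT₁.trans hT'
      have h2T' : 2 * (T / 2 ^ (k + 1)) = T / 2 ^ k := by rw [pow_succ]; field_simp
      have hT'T : T / 2 ^ (k + 1) ≤ T := div_le_self hTpos.le (one_le_pow₀ (by norm_num))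
      -- the block `[T', 2T']`, `T' = T/2^(k+1)`
      have hblock := hB (T / 2 ^ (k + 1)) hT' h hh hh1
      rw [h2T'] at hblock
      have hblock' : A * (T / 2 ^ (k + 1) * Real.log (3 + h * Real.log (T / 2 ^ (k + 1)))) ≤
          A * (T / 2 ^ (k + 1) * Real.log (3 + h * Real.log T)) :=
        mul_le_mul_of_nonneg_left (mul_le_mul_of_nonneg_left
          (hℓmono T (T / 2 ^ (k + 1)) hT'1 hT'T h hh) (by linarith)) hA0
      -- the rest by induction
      have hrest := ih T (hT'.trans hTk) h hh hh1
      have hadd := intervalIntegral.integral_add_adjacent_intervals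
        (hiF h hh hh1 (T / 2 ^ (k + 1)) (T / 2 ^ k) (by linarith) hTk)
        (hiF h hh hh1 (T / 2 ^ k) T (by positivity) (div_le_self hTpos.le (one_le_pow₀ (by norm_num))))
      rw [← hadd]
      have e : A * (T * Real.log (3 + h * Real.log T)) * (1 - (1 / 2) ^ (k + 1)) =
          A * (T / 2 ^ (k + 1) * Real.log (3 + h * Real.log T)) +
            A * (T * Real.log (3 + h * Real.log T)) * (1 - (1 / 2) ^ k) := by
        rw [pow_succ, pow_succ, one_div, inv_pow]
        field_simp
        ring
      rw [e]
      exact add_le_add (hblock.trans hblock') hrest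
  -- the bottom `[0, 2T₁]`, uniformly in `h`
  obtain ⟨CS, hCS0, hCS⟩ := exists_abs_zetaArgS_le 0 (2 * T₁ + 1)
  have hlow : ∀ h : ℝ, 0 ≤ h → h ≤ 1 →
      ∫ t in (0 : ℝ)..2 * T₁, (zetaArgS (t + h) - zetaArgS t) ^ 2 ≤ (2 * CS) ^ 2 * (2 * T₁) := by
    intro h hh hh1
    have hpt : ∀ t ∈ Icc (0 : ℝ) (2 * T₁), (zetaArgS (t + h) - zetaArgS t) ^ 2 ≤ (2 * CS) ^ 2 := by
      intro t ht
      have h1 := hCS (t + h) ⟨by linarith [ht.1], by linarith [ht.2]⟩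
      have h2 := hCS t ⟨ht.1, by linarith [ht.2]⟩
      have h3 : |zetaArgS (t + h) - zetaArgS t| ≤ 2 * CS := by
        calc |zetaArgS (t + h) - zetaArgS t| ≤ |zetaArgS (t + h)| + |zetaArgS t| := abs_sub _ _
          _ ≤ 2 * CS := by linarith
      calc (zetaArgS (t + h) - zetaArgS t) ^ 2 = |zetaArgS (t + h) - zetaArgS t| ^ 2 := (sq_abs _).symm
        _ ≤ (2 * CS) ^ 2 := pow_le_pow_left₀ (abs_nonneg _) h3 2
    have := intervalIntegral.integral_mono_on (by linarith) (hiF h hh hh1 0 (2 * T₁) le_rfl (by linarith))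
      intervalIntegrable_const hpt
    rw [intervalIntegral.integral_const, smul_eq_mul, sub_zero] at this
    linarith
  -- assemble
  refine ⟨A + (2 * CS) ^ 2 * (2 * T₁), 2 * T₁, fun T hT h hh hh1 ↦ ?_⟩
  have hT1 : 1 ≤ T := by linarith
  have hTT₁ : 1 ≤ T / T₁ := by rw [le_div_iff₀ (by linarith)]; linarith
  obtain ⟨k, hk1, hk2⟩ := exists_nat_pow_near hTT₁ one_lt_two
  have h2k : (0 : ℝ) < 2 ^ k := by positivity
  have hk1' : T₁ ≤ T / 2 ^ k := by
    rw [le_div_iff₀ h2k]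
    have := (le_div_iff₀ (by linarith : (0 : ℝ) < T₁)).1 hk1
    linarith
  have hk2' : T / 2 ^ k ≤ 2 * T₁ := by
    rw [div_le_iff₀ h2k]
    have := (div_lt_iff₀ (by linarith : (0 : ℝ) < T₁)).1 hk2
    rw [pow_succ] at this
    linarith
  have hadd := intervalIntegral.integral_add_adjacent_intervals
    (hiF h hh hh1 0 (T / 2 ^ k) le_rfl (by positivity))
    (hiF h hh hh1 (T / 2 ^ k) T (by positivity) (div_le_self (by linarith) (one_le_pow₀ (by norm_num))))
  rw [← hadd]
  have hpart1 : ∫ t in (0 : ℝ)..T / 2 ^ k, (zetaArgS (t + h) - zetaArgS t) ^ 2 ≤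
      (2 * CS) ^ 2 * (2 * T₁) :=
    (intervalIntegral.integral_mono_interval le_rfl (by positivity) hk2'
      (Eventually.of_forall fun t ↦ sq_nonneg _) (hiF h hh hh1 0 (2 * T₁) le_rfl (by linarith))).trans
        (hlow h hh hh1)
  have hpart2 := hdy k T hk1' h hh hh1
  have hℓT := hℓ T hT1 h hh
  have hTℓ : 1 ≤ T * Real.log (3 + h * Real.log T) := by nlinarith
  have hhalf : 0 ≤ (1 / 2 : ℝ) ^ k := by positivity
  have hATℓ : 0 ≤ A * (T * Real.log (3 + h * Real.log T)) := by positivity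
  calc (∫ t in (0 : ℝ)..T / 2 ^ k, (zetaArgS (t + h) - zetaArgS t) ^ 2) +
        ∫ t in T / 2 ^ k..T, (zetaArgS (t + h) - zetaArgS t) ^ 2
      ≤ (2 * CS) ^ 2 * (2 * T₁) + A * (T * Real.log (3 + h * Real.log T)) * (1 - (1 / 2) ^ k) :=
        add_le_add hpart1 hpart2
    _ ≤ (2 * CS) ^ 2 * (2 * T₁) * (T * Real.log (3 + h * Real.log T)) +
          A * (T * Real.log (3 + h * Real.log T)) := by
        have h1 : (2 * CS) ^ 2 * (2 * T₁) ≤ (2 * CS) ^ 2 * (2 * T₁) * (T * Real.log (3 + h * Real.log T)) :=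
          le_mul_of_one_le_right (by positivity) hTℓ
        nlinarith
    _ = (A + (2 * CS) ^ 2 * (2 * T₁)) * (T * Real.log (3 + h * Real.log T)) := by ring

end SelbergFujii

/-! ### Both gap facts from the approximate formula -/

open SelbergFujii in
/-- **Selberg–Fujii small gaps from Selberg's mean-value approximate formula for `S(t)`.** The
named fact `Literature.NumberTheory.LFunctions.selberg_fujii_small_gaps` ((9.25.6)) follows from
the single hypothesis `hAF` — the display of Titchmarsh's Theorem 14.22,
`∫_{T/2}^{T} (S(t) + π⁻¹ ∑_{p ≤ y} sin(t log p)/√p)² dt = O(T)` for `T^a ≤ y ≤ T^b`, for SOME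
exponents `0 < a < b ≤ 1/4` (Titchmarsh proves it on the Riemann hypothesis for `x² = y` with any
`T^{a'} ≤ x ≤ T^{1/2}`; unconditionally it is Selberg's theorem (*Contributions*, 1946) by way of
his density theorem near `σ = 1/2`, Titchmarsh Thm. 9.19 (C), cf. the notes §9.25 and §14.35) —
through `abs_moment_of_approxFormula` (hypothesis `hS`) and
`selberg_fujii_small_gaps_of_abs_moment`. After this theorem `hAF` is the whole remaining
(unproved, unvendored) analytic input of the Selberg–Fujii cluster.
[cite: Titchmarsh1986, Thm. 14.22, §9.25 (9.25.6) and §9.26] -/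
theorem selberg_fujii_small_gaps_of_approxFormula
    (hAF : ∃ a b : ℝ, 0 < a ∧ a < b ∧ b ≤ 1 / 4 ∧ ∃ C : ℝ, ∃ T₀ : ℝ, ∀ T : ℝ, T₀ ≤ T →
      ∀ y : ℝ, T ^ a ≤ y → y ≤ T ^ b →
        ∫ t in T / 2..T, (zetaArgS t + π⁻¹ * ∑ p ∈ Nat.primesLE ⌊y⌋₊,
          Real.sin (t * Real.log p) / Real.sqrt p) ^ 2 ≤ C * T) :
    selberg_fujii_small_gaps :=
  selberg_fujii_small_gaps_of_abs_moment (abs_moment_of_approxFormula hAF)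

open SelbergFujii in
/-- **Selberg–Fujii large gaps from Selberg's mean-value approximate formula for `S(t)`.** The
named fact `Literature.NumberTheory.LFunctions.selberg_fujii_large_gaps` ((9.25.5)) follows from
the same single hypothesis `hAF` (see `selberg_fujii_small_gaps_of_approxFormula`), through
`abs_moment_of_approxFormula` (`hS`), `meanSquare_block_of_approxFormula` and
`meanSquare_of_block` (`h2`), and `selberg_fujii_large_gaps_of_abs_moment'`.
[cite: Titchmarsh1986, Thm. 14.22, §9.25 (9.25.5) and §9.26] -/
theorem selberg_fujii_large_gaps_of_approxFormula
    (hAF : ∃ a b : ℝ, 0 < a ∧ a < b ∧ b ≤ 1 / 4 ∧ ∃ C : ℝ, ∃ T₀ : ℝ, ∀ T : ℝ, T₀ ≤ T →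
      ∀ y : ℝ, T ^ a ≤ y → y ≤ T ^ b →
        ∫ t in T / 2..T, (zetaArgS t + π⁻¹ * ∑ p ∈ Nat.primesLE ⌊y⌋₊,
          Real.sin (t * Real.log p) / Real.sqrt p) ^ 2 ≤ C * T) :
    selberg_fujii_large_gaps :=
  selberg_fujii_large_gaps_of_abs_moment' (abs_moment_of_approxFormula hAF)
    (meanSquare_of_block (meanSquare_block_of_approxFormula hAF))

end Literature.NumberTheory.LFunctions

end
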